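import Literature.AlgebraicGeometry.HodgeTheory.ProjectiveRegularityGeneratesSaturation
import Literature.AlgebraicGeometry.HodgeTheory.ProjectiveIdealSheafH1Normality
import Literature.AlgebraicGeometry.HodgeTheory.ProjectiveHilbertFunctionBound
import HarnessLib

/-!
# An `m`-regular ideal sheaf is `n`-normal for all `n ≥ m - 1` (Mumford, Lecture 14; Eisenbud, GoS §4)

For a submodule sheaf `K~ ⊆ F_e~` on `ℙ^r` (e.g. an ideal sheaf `𝓘_X`), `m`-regularity gives by
Castelnuovo's lemma (b) `H¹(K~(n)) = 0` for all `n ≥ m - 1`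
(`ProjectiveRegularityGeneratesSaturation.isZero_homology_cech_of_regular`), and for `r ≥ 2` the
vanishing of `H¹(K~(n))` is exactly the surjectivity of `(F_e)_n → Γ((F_e ⧸ K)~(n))`
(`LaurentCechIdealSheafSequence`). Hence ("`X` is `n`-normal for `n ≥ reg 𝓘_X - 1`"):

* `LaurentCech.surjective_homologyMap_π_zero_of_regular` — `H⁰(Č_n(F_e)) ↠ H⁰(Č_n(F_e ⧸ K))` for
  `n ≥ m - 1`;
* **`LaurentCech.nonempty_quotient_degPiece_sat_linearEquiv_of_regular`** —
  `(F_e)_n ⧸ K̄_n ≃ H⁰(Č_n(F_e ⧸ K))` for `n ≥ m - 1`: the global sections of `(F_e ⧸ K)~(n)` are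
  exactly the degree-`n` piece of `F_e ⧸ K̄`;
* `LaurentCech.finrank_homology_quot_zero_add_of_regular` — `h⁰(Č_n(F_e ⧸ K)) + dim K̄_n = dim (F_e)_n`;
  for `X = V(I) ⊆ ℙ^r`, `n ≥ max(m - 1, 0)`: **`h⁰(𝒪_X(n)) + dim Ī_n = C(n + r, r)`**
  (`LaurentCech.finrank_homology_quot_zero_add_choose_of_regular`);
* `LaurentCech.mem_span_isHomog_of_regular` — `K̄_{n+1} = P₁ · K̄_n` for `n ≥ m` (degree-wise generation).

(`k` an infinite field, `r ≥ 2`, `K` graded.)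

## References

* [Mumford1966CurvesSurface] D. Mumford, *Lectures on Curves on an Algebraic Surface*, Lecture 14
  (pp. 99–101).
* [Eisenbud2005] D. Eisenbud, *The Geometry of Syzygies*, GTM 229, Springer 2005, Thm. 4.2, Cor. 4.18.
* [Hartshorne1977] R. Hartshorne, *Algebraic Geometry*, II Ex. 5.14 (d) (p. 126), III Ex. 5.5 (a) (p. 231).
-/

noncomputable section

open CategoryTheory CategoryTheory.Limits

universe u

namespace Literature.Algebra.Homology

namespace LaurentCech

open OrderedCech TopCohomology

variable {k : Type u} [Field k] [Infinite k] {r : ℕ} {J : Type} [Fintype J] (e : J → ℤ)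

/-- **`m`-regular `K~` ⇒ `H⁰(Č_n(F_e)) → H⁰(Č_n(F_e ⧸ K))` is onto for `n ≥ m - 1`** (`r ≥ 2`):
`H¹(Č_n(K)) = 0` there by Castelnuovo (b). [cite: Mumford1966CurvesSurface, Lecture 14 (pp. 99–100)]
[cite: Hartshorne1977, III Ex. 5.5 (a) (p. 231)] -/
theorem surjective_homologyMap_π_zero_of_regular (hr : 2 ≤ r) {K : Submodule (P k r) (J → P k r)}
    (hK : IsGraded e K) (m : ℤ) (hm : ∀ i : ℤ, 1 ≤ i → IsZero ((cech e K (m - i)).homology i))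
    {n : ℤ} (hn : m - 1 ≤ n) :
    Function.Surjective
      (HomologicalComplex.homologyMap (cokernel.π (inclusion e K ⊤ le_top n)) 0).hom :=
  surjective_homologyMap_π_zero_of_isZero e K n hr
    (isZero_homology_cech_of_regular e hK m hm 1 le_rfl n hn)

/-- **`(F_e)_n ⧸ K̄_n ≃ H⁰(Č_n(F_e ⧸ K))` for `n ≥ m - 1`** when `K~` is `m`-regular (`r ≥ 2`): beyond
the regularity the global sections of `(F_e ⧸ K)~(n)` are the degree-`n` piece of `F_e ⧸ K̄`.
[cite: Mumford1966CurvesSurface, Lecture 14 (pp. 99–101)] [cite: Eisenbud2005, Thm. 4.2 (p. 56)] -/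
theorem nonempty_quotient_degPiece_sat_linearEquiv_of_regular (hr : 2 ≤ r)
    {K : Submodule (P k r) (J → P k r)} (hK : IsGraded e K) (m : ℤ)
    (hm : ∀ i : ℤ, 1 ≤ i → IsZero ((cech e K (m - i)).homology i)) {n : ℤ} (hn : m - 1 ≤ n) :
    Nonempty ((((∀ j, (Ldeg k r (n - e j)).comap (toL k r).toLinearMap) ⧸ degPiece e (sat K) n)
      ≃ₗ[k] ((quot e K n).homology 0))) :=
  nonempty_quotient_degPiece_sat_linearEquiv_of_surjective e (one_le_two.trans hr) K n
    (surjective_homologyMap_π_zero_of_regular e hr hK m hm hn)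

/-- **`h⁰(Č_n(F_e ⧸ K)) + dim K̄_n = dim (F_e)_n` for `n ≥ m - 1`** when `K~` is `m`-regular (`r ≥ 2`).
[cite: Mumford1966CurvesSurface, Lecture 14 (pp. 99–101)] [cite: Eisenbud2005, Cor. 4.18 (p. 103)] -/
theorem finrank_homology_quot_zero_add_of_regular (hr : 2 ≤ r) {K : Submodule (P k r) (J → P k r)}
    (hK : IsGraded e K) (m : ℤ) (hm : ∀ i : ℤ, 1 ≤ i → IsZero ((cech e K (m - i)).homology i))
    {n : ℤ} (hn : m - 1 ≤ n) :
    Module.finrank k ((quot e K n).homology 0) + Module.finrank k (degPiece e (sat K) n) =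
      Module.finrank k (∀ j, (Ldeg k r (n - e j)).comap (toL k r).toLinearMap) := by
  have h := finrank_homology_cech_one_add e hr hK n
  haveI := ModuleCat.subsingleton_of_isZero (isZero_homology_cech_of_regular e hK m hm 1 le_rfl n hn)
  rw [Module.finrank_zero_of_subsingleton, zero_add] at h
  exact h.symm

/-- For `X = V(I) ⊆ ℙ^r_k` with `𝓘_X = I~` `m`-regular (`I ⊆ S` graded, `r ≥ 2`):
**`h⁰(𝒪_X(n)) + dim Ī_n = C(n + r, r)` for all `n ≥ max(m - 1, 0)`** — the hypersurfaces of degree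
`n` cut out the complete linear series `|𝒪_X(n)|`. [cite: Mumford1966CurvesSurface, Lecture 14 (pp. 99–101)]
[cite: Hartshorne1977, II Ex. 5.14 (d) (p. 126)] -/
theorem finrank_homology_quot_zero_add_choose_of_regular (hr : 2 ≤ r)
    {I : Submodule (P k r) (Unit → P k r)} (hI : IsGraded (fun _ : Unit => (0 : ℤ)) I) (m : ℤ)
    (hm : ∀ i : ℤ, 1 ≤ i → IsZero ((cech (fun _ : Unit => (0 : ℤ)) I (m - i)).homology i))
    {n : ℤ} (hn : m - 1 ≤ n) (hn0 : 0 ≤ n) :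
    Module.finrank k ((quot (fun _ : Unit => (0 : ℤ)) I n).homology 0) +
        Module.finrank k (degPiece (fun _ : Unit => (0 : ℤ)) (sat I) n) = (n.toNat + r).choose r := by
  have h := finrank_homology_cech_one_add_choose hr hI hn0
  haveI := ModuleCat.subsingleton_of_isZero
    (isZero_homology_cech_of_regular (fun _ : Unit => (0 : ℤ)) hI m hm 1 le_rfl n hn)
  rw [Module.finrank_zero_of_subsingleton, zero_add] at h
  exact h.symm

/-- **`K̄_{n+1} = P₁ · K̄_n` for `n ≥ m`** when `K~` is `m`-regular (`r ≥ 1`, `k` infinite): every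
homogeneous element of `K̄` of degree `n + 1` is a `P`-combination of homogeneous elements of `K̄` of
degree `n` — Castelnuovo (a) for `K~` transported along `globalSectionsEquivSat`
(`mem_span_of_top_le_iSup_range_smulMap`). [cite: Mumford1966CurvesSurface, Lecture 14 (pp. 99–102)]
[cite: Hartshorne1977, II Ex. 5.10 (c) (p. 125)] -/
theorem mem_span_isHomog_of_regular (hr : 1 ≤ r) {K : Submodule (P k r) (J → P k r)}
    (hK : IsGraded e K) (m : ℤ) (hm : ∀ i : ℤ, 1 ≤ i → IsZero ((cech e K (m - i)).homology i))
    {n : ℤ} (hn : m ≤ n) {v : J → P k r} (hv : v ∈ sat K) (hhom : IsHomog e (n + 1) v) :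
    v ∈ Submodule.span (P k r) {w : J → P k r | w ∈ sat K ∧ IsHomog e n w} :=
  mem_span_of_top_le_iSup_range_smulMap e hr K n
    (top_le_iSup_range_homologyMap_smulMap_of_regular e hr hK m hm hn) hv hhom

end LaurentCech

end Literature.Algebra.Homology

end
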